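import Literature.Geometry.Symplectic.SphereCRJetMaps
import Literature.Geometry.Symplectic.SphereCROperatorGlobal
import HarnessLib

/-!
# The chart Cauchy–Riemann operators as smooth maps of Hölder section spaces

Layer B4b of the analytic core of the Hofer–Lizan–Sikorav local foliation theorem (Wendl 2018,
Thm. 2.46; lead of crux `WitnessCharge`, summit `SmoothPoincare4`). For chart data
`𝒥 : SphereACData` we realise the transported Cauchy–Riemann operators of the two product
charts (`crOp₀`, `crOp₁` of `SphereCROperatorPointwise.lean`) as ONE smooth map of Banach
spaces

  `y = (ξ, f) ∈ SecPair k r = 𝓗^{k+1,r}_{-w²} × 𝓗^{k+1,r}_1  ⟼  (PT y, PN y)`,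

pairs of `C^{k,r}_b` functions on `ℂ` (tangent and normal components, chart `0` and chart `1`):
`out₀ y = ρ • (φ₀ ∘ jets₀ y)` is the Nemytskii operator of the globally smooth cut-off jet
operator `φ₀ = phiCut₀` (`SphereCROperatorGlobal.lean`) applied to the affine 1-jet map `jets₀`
(`SphereCRJetMaps.lean`), cut off by `ρ = rhoCut`; likewise `out₁`. We prove:

* smoothness and the Fréchet derivative (`contDiff_out₀`, `hasFDerivAt_out₀`,
  `dout₀_apply : (D out₀ y δ) z = ρ z • Dφ₀(jets₀ y z) (jets₀CLM δ z)`) — chain rule with the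
  Nemytskii theorem `contDiff_compLeft`;
* the value at the zero section is `0` (`out₀_zero`);
* on the SMALL set `{‖cutSec₀ ξ‖, ‖cutSec₁ ξ‖ < 1/4}` (open, `isOpen_small`) the outputs are the
  honest operators: `out₀ y z = ρ z • crOp₀ (sec₀ ξ) (sec₀ f) z` for `‖z‖ < 4`
  (`out₀_apply_of_small`), and
* **membership**: there `PT y ∈ 𝓗^{k,r}_{dbarClutch (-w²)}` and `PN y ∈ 𝓗^{k,r}_{dbarClutch 1}`
  (`PT_mem`, `PN_mem`) — the clutching law `crOp₁_eq`.

The identification of the derivative at `0` with `[[2∂̄_T, M], [0, 2∂̄ + A]]` is the next layer.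

## References

* C. Wendl, *Holomorphic Curves in Low Dimensions*, LNM 2216 (2018), §2.3, Thm. 2.46. [Wendl2018]
-/

noncomputable section

open Set Filter Metric Function Complex
open scoped Topology NNReal ContDiff
open Literature.Analysis.FunctionSpaces Literature.Analysis.Complex.RiemannSphere
open Literature.Analysis.Complex.ProjectiveLineExpChart Literature.Geometry.Symplectic.CRExpression

namespace Literature.Geometry.Symplectic

namespace SphereCR

namespace SphereACData

variable (𝒥 : SphereACData) {r : ℝ≥0} (hr : r ≤ 1) (k : ℕ)

/-! ### Chart `0`: the Nemytskii operator of `φ₀` on the jets, cut off by `ρ` -/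

/-- `raw₀ y = φ₀ ∘ jets₀ y ∈ C^{k,r}_b(ℂ, ℂ × ℂ)` (Nemytskii operator of the globally smooth
cut-off jet operator). [cite: Wendl2018, Thm. 2.46] -/
def raw₀ (y : SecPair k r) : ContDiffHolderFunction ℂ (ℂ × ℂ) k r :=
  ContDiffHolderFunction.compLeft hr 𝒥.phiCut₀
    (𝒥.contDiff_phiCut₀.of_le (by exact_mod_cast le_top)) (jets₀ hr k y)

/-- Pointwise: `raw₀ y z = φ₀ (jets₀ y z)`. [folklore] -/
@[simp] theorem raw₀_apply (y : SecPair k r) (z : ℂ) :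
    𝒥.raw₀ hr k y z = 𝒥.phiCut₀ (jets₀ hr k y z) := rfl

/-- `raw₀` is `C^∞` (Nemytskii ∘ affine). [cite: GilbargTrudinger2001, §4.1] -/
theorem contDiff_raw₀ : ContDiff ℝ ∞ (𝒥.raw₀ hr k) :=
  (ContDiffHolderFunction.contDiff_compLeft hr 𝒥.phiCut₀ 𝒥.contDiff_phiCut₀).1.comp
    (contDiff_jets₀ hr k)

/-- The derivative of `raw₀` at `y`: `δ ↦ (Dφ₀ ∘ jets₀ y) · jets₀CLM δ`. [folklore] -/
def draw₀ (y : SecPair k r) : SecPair k r →L[ℝ] ContDiffHolderFunction ℂ (ℂ × ℂ) k r :=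
  (ContDiffHolderFunction.bilinearCLM hr (ContinuousLinearMap.id ℝ (Jet →L[ℝ] ℂ × ℂ))
    (ContDiffHolderFunction.compLeft hr (fderiv ℝ 𝒥.phiCut₀)
      ((𝒥.contDiff_phiCut₀.fderiv_right (m := ∞) le_rfl).of_le (by exact_mod_cast le_top))
      (jets₀ hr k y))).comp (jets₀CLM hr k)

/-- Pointwise: `draw₀ y δ z = Dφ₀ (jets₀ y z) (jets₀CLM δ z)`. [folklore] -/
@[simp] theorem draw₀_apply (y δ : SecPair k r) (z : ℂ) :
    𝒥.draw₀ hr k y δ z = (fderiv ℝ 𝒥.phiCut₀ (jets₀ hr k y z)) (jets₀CLM hr k δ z) := rfl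

/-- `raw₀` has derivative `draw₀ y` at `y`. [cite: GilbargTrudinger2001, §4.1] -/
theorem hasFDerivAt_raw₀ (y : SecPair k r) : HasFDerivAt (𝒥.raw₀ hr k) (𝒥.draw₀ hr k y) y :=
  ((ContDiffHolderFunction.contDiff_compLeft hr 𝒥.phiCut₀ 𝒥.contDiff_phiCut₀).2
    (jets₀ hr k y)).comp y (hasFDerivAt_jets₀ hr k y)

/-- **The chart-`0` output** `out₀ y = ρ • (φ₀ ∘ jets₀ y)`. [cite: Wendl2018, Thm. 2.46] -/
def out₀ (y : SecPair k r) : ContDiffHolderFunction ℂ (ℂ × ℂ) k r :=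
  ContDiffHolderFunction.coeffCLM hr rhoCut contDiff_rhoCut hasCompactSupport_rhoCut
    (𝒥.raw₀ hr k y)

/-- Pointwise: `out₀ y z = ρ z • φ₀ (jets₀ y z)`. [folklore] -/
@[simp] theorem out₀_apply (y : SecPair k r) (z : ℂ) :
    𝒥.out₀ hr k y z = rhoCut z • 𝒥.phiCut₀ (jets₀ hr k y z) := rfl

/-- `out₀` is `C^∞`. [folklore] -/
theorem contDiff_out₀ : ContDiff ℝ ∞ (𝒥.out₀ hr k) :=
  (ContDiffHolderFunction.coeffCLM hr rhoCut contDiff_rhoCut hasCompactSupport_rhoCut).contDiff.comp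
    (𝒥.contDiff_raw₀ hr k)

/-- The derivative of `out₀` at `y`. [folklore] -/
def dout₀ (y : SecPair k r) : SecPair k r →L[ℝ] ContDiffHolderFunction ℂ (ℂ × ℂ) k r :=
  (ContDiffHolderFunction.coeffCLM hr rhoCut contDiff_rhoCut hasCompactSupport_rhoCut).comp
    (𝒥.draw₀ hr k y)

/-- Pointwise: `dout₀ y δ z = ρ z • Dφ₀ (jets₀ y z) (jets₀CLM δ z)`. [folklore] -/
@[simp] theorem dout₀_apply (y δ : SecPair k r) (z : ℂ) :
    𝒥.dout₀ hr k y δ z = rhoCut z • (fderiv ℝ 𝒥.phiCut₀ (jets₀ hr k y z)) (jets₀CLM hr k δ z) :=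
  rfl

/-- `out₀` has derivative `dout₀ y` at `y`. [folklore] -/
theorem hasFDerivAt_out₀ (y : SecPair k r) : HasFDerivAt (𝒥.out₀ hr k) (𝒥.dout₀ hr k y) y :=
  (ContDiffHolderFunction.coeffCLM hr rhoCut contDiff_rhoCut
    hasCompactSupport_rhoCut).hasFDerivAt.comp y (𝒥.hasFDerivAt_raw₀ hr k y)

/-- **The zero section is a zero**: `out₀ 0 = 0` (`φ₀ (z', 0, 0, 0, 0) = 0`). [folklore] -/
theorem out₀_zero : 𝒥.out₀ hr k 0 = 0 := by
  ext z
  · simp [jets₀_zero, 𝒥.phiCut₀_axis]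
  · simp [jets₀_zero, 𝒥.phiCut₀_axis]

/-- Off the disc of radius `3` the output vanishes. [folklore] -/
theorem out₀_apply_of_le (y : SecPair k r) {z : ℂ} (hz : 3 ≤ ‖z‖) : 𝒥.out₀ hr k y z = 0 := by
  rw [out₀_apply, rhoCut_eq_zero hz, zero_smul]

/-! ### Chart `1` -/

/-- `raw₁ y = φ₁ ∘ jets₁ y`. [cite: Wendl2018, Thm. 2.46] -/
def raw₁ (y : SecPair k r) : ContDiffHolderFunction ℂ (ℂ × ℂ) k r :=
  ContDiffHolderFunction.compLeft hr 𝒥.phiCut₁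
    (𝒥.contDiff_phiCut₁.of_le (by exact_mod_cast le_top)) (jets₁ hr k y)

/-- Pointwise: `raw₁ y w = φ₁ (jets₁ y w)`. [folklore] -/
@[simp] theorem raw₁_apply (y : SecPair k r) (w : ℂ) :
    𝒥.raw₁ hr k y w = 𝒥.phiCut₁ (jets₁ hr k y w) := rfl

/-- `raw₁` is `C^∞`. [cite: GilbargTrudinger2001, §4.1] -/
theorem contDiff_raw₁ : ContDiff ℝ ∞ (𝒥.raw₁ hr k) :=
  (ContDiffHolderFunction.contDiff_compLeft hr 𝒥.phiCut₁ 𝒥.contDiff_phiCut₁).1.comp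
    (contDiff_jets₁ hr k)

/-- The derivative of `raw₁` at `y`. [folklore] -/
def draw₁ (y : SecPair k r) : SecPair k r →L[ℝ] ContDiffHolderFunction ℂ (ℂ × ℂ) k r :=
  (ContDiffHolderFunction.bilinearCLM hr (ContinuousLinearMap.id ℝ (Jet →L[ℝ] ℂ × ℂ))
    (ContDiffHolderFunction.compLeft hr (fderiv ℝ 𝒥.phiCut₁)
      ((𝒥.contDiff_phiCut₁.fderiv_right (m := ∞) le_rfl).of_le (by exact_mod_cast le_top))
      (jets₁ hr k y))).comp (jets₁CLM hr k)

/-- Pointwise: `draw₁ y δ w = Dφ₁ (jets₁ y w) (jets₁CLM δ w)`. [folklore] -/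
@[simp] theorem draw₁_apply (y δ : SecPair k r) (w : ℂ) :
    𝒥.draw₁ hr k y δ w = (fderiv ℝ 𝒥.phiCut₁ (jets₁ hr k y w)) (jets₁CLM hr k δ w) := rfl

/-- `raw₁` has derivative `draw₁ y` at `y`. [cite: GilbargTrudinger2001, §4.1] -/
theorem hasFDerivAt_raw₁ (y : SecPair k r) : HasFDerivAt (𝒥.raw₁ hr k) (𝒥.draw₁ hr k y) y :=
  ((ContDiffHolderFunction.contDiff_compLeft hr 𝒥.phiCut₁ 𝒥.contDiff_phiCut₁).2
    (jets₁ hr k y)).comp y (hasFDerivAt_jets₁ hr k y)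

/-- **The chart-`1` output** `out₁ y = ρ • (φ₁ ∘ jets₁ y)`. [cite: Wendl2018, Thm. 2.46] -/
def out₁ (y : SecPair k r) : ContDiffHolderFunction ℂ (ℂ × ℂ) k r :=
  ContDiffHolderFunction.coeffCLM hr rhoCut contDiff_rhoCut hasCompactSupport_rhoCut
    (𝒥.raw₁ hr k y)

/-- Pointwise: `out₁ y w = ρ w • φ₁ (jets₁ y w)`. [folklore] -/
@[simp] theorem out₁_apply (y : SecPair k r) (w : ℂ) :
    𝒥.out₁ hr k y w = rhoCut w • 𝒥.phiCut₁ (jets₁ hr k y w) := rfl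

/-- `out₁` is `C^∞`. [folklore] -/
theorem contDiff_out₁ : ContDiff ℝ ∞ (𝒥.out₁ hr k) :=
  (ContDiffHolderFunction.coeffCLM hr rhoCut contDiff_rhoCut hasCompactSupport_rhoCut).contDiff.comp
    (𝒥.contDiff_raw₁ hr k)

/-- The derivative of `out₁` at `y`. [folklore] -/
def dout₁ (y : SecPair k r) : SecPair k r →L[ℝ] ContDiffHolderFunction ℂ (ℂ × ℂ) k r :=
  (ContDiffHolderFunction.coeffCLM hr rhoCut contDiff_rhoCut hasCompactSupport_rhoCut).comp
    (𝒥.draw₁ hr k y)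

/-- Pointwise: `dout₁ y δ w = ρ w • Dφ₁ (jets₁ y w) (jets₁CLM δ w)`. [folklore] -/
@[simp] theorem dout₁_apply (y δ : SecPair k r) (w : ℂ) :
    𝒥.dout₁ hr k y δ w = rhoCut w • (fderiv ℝ 𝒥.phiCut₁ (jets₁ hr k y w)) (jets₁CLM hr k δ w) :=
  rfl

/-- `out₁` has derivative `dout₁ y` at `y`. [folklore] -/
theorem hasFDerivAt_out₁ (y : SecPair k r) : HasFDerivAt (𝒥.out₁ hr k) (𝒥.dout₁ hr k y) y :=
  (ContDiffHolderFunction.coeffCLM hr rhoCut contDiff_rhoCut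
    hasCompactSupport_rhoCut).hasFDerivAt.comp y (𝒥.hasFDerivAt_raw₁ hr k y)

/-- `out₁ 0 = 0`. [folklore] -/
theorem out₁_zero : 𝒥.out₁ hr k 0 = 0 := by
  ext w
  · simp [jets₁_zero, 𝒥.phiCut₁_axis]
  · simp [jets₁_zero, 𝒥.phiCut₁_axis]

/-- Off the disc of radius `3` the chart-`1` output vanishes. [folklore] -/
theorem out₁_apply_of_le (y : SecPair k r) {w : ℂ} (hw : 3 ≤ ‖w‖) : 𝒥.out₁ hr k y w = 0 := by
  rw [out₁_apply, rhoCut_eq_zero hw, zero_smul]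

/-! ### The small set: where the outputs are the honest operators -/

/-- **Smallness** of `y = (ξ, f)`: both cut-off representatives of the tangent section `ξ` have
`C^{k+1,r}`-norm `< 1/4` (so `|ξ| < 1/4` on the discs of radius `4` of both charts: the exponential
chart is nondegenerate and the image avoids the poles). [cite: Wendl2018, Thm. 2.46] -/
def Small (y : SecPair k r) : Prop :=
  ‖cutSec₀CLM neg_sq_clutch_ne_zero contDiffOn_neg_sq_clutch hr y.1‖ < 4⁻¹ ∧
    ‖cutSec₁CLM contDiffOn_neg_sq_clutch hr y.1‖ < 4⁻¹

/-- The small set is open. [folklore] -/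
theorem isOpen_small : IsOpen {y : SecPair k r | Small hr k y} := by
  refine IsOpen.inter ?_ ?_
  · exact isOpen_lt ((cutSec₀CLM neg_sq_clutch_ne_zero contDiffOn_neg_sq_clutch
      hr).continuous.norm.comp continuous_fst) continuous_const
  · exact isOpen_lt ((cutSec₁CLM (τ := fun w : ℂ => -w ^ 2) contDiffOn_neg_sq_clutch
      hr).continuous.norm.comp continuous_fst) continuous_const

/-- `0` is small. [folklore] -/
theorem small_zero : Small hr k (0 : SecPair k r) := by
  constructor <;> simp

variable {hr k}

/-- On the disc `‖z‖ ≤ 4`, `|sec₀ ξ z| < 1/4` for small `y`. [folklore] -/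
theorem norm_sec₀_lt_of_small {y : SecPair k r} (hy : Small hr k y) {z : ℂ} (hz : ‖z‖ ≤ 4) :
    ‖sec₀ (fun w : ℂ => -w ^ 2) y.1.1 z‖ < 4⁻¹ := by
  have h := ContDiffHolderFunction.norm_apply_le_norm
    (cutSec₀CLM neg_sq_clutch_ne_zero contDiffOn_neg_sq_clutch hr y.1) z
  rw [cutSec₀CLM_apply_of_norm_le _ _ hr y.1 hz] at h
  exact h.trans_lt hy.1

/-- On the disc `‖w‖ ≤ 4`, `|sec₁ ξ w| < 1/4` for small `y`. [folklore] -/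
theorem norm_sec₁_lt_of_small {y : SecPair k r} (hy : Small hr k y) {w : ℂ} (hw : ‖w‖ ≤ 4) :
    ‖sec₁ (fun w : ℂ => -w ^ 2) y.1.1 w‖ < 4⁻¹ := by
  have h := ContDiffHolderFunction.norm_apply_le_norm
    (cutSec₁CLM (τ := fun w : ℂ => -w ^ 2) contDiffOn_neg_sq_clutch hr y.1) w
  rw [cutSec₁CLM_apply_of_norm_le _ hr y.1 hw] at h
  exact h.trans_lt hy.2

/-- The representatives of a member of `𝓗^{k+1,r}` are differentiable. [folklore] -/
theorem differentiableAt_sec₀_T (y : SecPair k r) (z : ℂ) :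
    DifferentiableAt ℝ (sec₀ (fun w : ℂ => -w ^ 2) y.1.1) z :=
  ((contDiff_sec₀ y.1.2 neg_sq_clutch_ne_zero contDiffOn_neg_sq_clutch).differentiable
    (by simp)).differentiableAt

/-- The representatives of a member of `𝓗^{k+1,r}` are differentiable. [folklore] -/
theorem differentiableAt_sec₀_N (y : SecPair k r) (z : ℂ) :
    DifferentiableAt ℝ (sec₀ (1 : ℂ → ℂ) y.2.1) z :=
  ((contDiff_sec₀ y.2.2 one_clutch_ne_zero contDiffOn_one_clutch).differentiable
    (by simp)).differentiableAt

/-- The representatives of a member of `𝓗^{k+1,r}` are differentiable. [folklore] -/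
theorem differentiableAt_sec₁_T (y : SecPair k r) (w : ℂ) :
    DifferentiableAt ℝ (sec₁ (fun w : ℂ => -w ^ 2) y.1.1) w :=
  ((contDiff_sec₁ y.1.2 contDiffOn_neg_sq_clutch).differentiable
    (by simp)).differentiableAt

/-- The representatives of a member of `𝓗^{k+1,r}` are differentiable. [folklore] -/
theorem differentiableAt_sec₁_N (y : SecPair k r) (w : ℂ) :
    DifferentiableAt ℝ (sec₁ (1 : ℂ → ℂ) y.2.1) w :=
  ((contDiff_sec₁ y.2.2 contDiffOn_one_clutch).differentiable
    (by simp)).differentiableAt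

/-- **On the small set the chart-`0` output is the honest operator**:
`out₀ y z = ρ z • crOp₀ (sec₀ ξ) (sec₀ f) z` for `‖z‖ < 4`. [cite: Wendl2018, Thm. 2.46] -/
theorem out₀_apply_of_small {y : SecPair k r} (hy : Small hr k y) {z : ℂ} (hz : ‖z‖ < 4) :
    𝒥.out₀ hr k y z =
      rhoCut z • 𝒥.crOp₀ (sec₀ (fun w : ℂ => -w ^ 2) y.1.1) (sec₀ (1 : ℂ → ℂ) y.2.1) z := by
  have hc : ‖sec₀ (fun w : ℂ => -w ^ 2) y.1.1 z‖ ≤ 1 :=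
    (norm_sec₀_lt_of_small hy hz.le).le.trans (by norm_num)
  have hden : den z (sec₀ (fun w : ℂ => -w ^ 2) y.1.1 z) ≠ 0 :=
    den_ne_zero_of_norm_lt_two (hc.trans_lt (by norm_num))
  rw [out₀_apply, jets₀_apply_of_norm_lt hr k y hz, 𝒥.phiCut₀_eq_jetOp₀ hc,
    𝒥.crOp₀_eq_jetOp₀ (differentiableAt_sec₀_T y z) (differentiableAt_sec₀_N y z) hden]

/-- **On the small set the chart-`1` output is the honest operator**:
`out₁ y w = ρ w • crOp₁ (sec₁ ξ) (sec₁ f) w` for `‖w‖ < 4`. [cite: Wendl2018, Thm. 2.46] -/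
theorem out₁_apply_of_small {y : SecPair k r} (hy : Small hr k y) {w : ℂ} (hw : ‖w‖ < 4) :
    𝒥.out₁ hr k y w =
      rhoCut w • 𝒥.crOp₁ (sec₁ (fun w : ℂ => -w ^ 2) y.1.1) (sec₁ (1 : ℂ → ℂ) y.2.1) w := by
  have hc : ‖sec₁ (fun w : ℂ => -w ^ 2) y.1.1 w‖ ≤ 1 :=
    (norm_sec₁_lt_of_small hy hw.le).le.trans (by norm_num)
  have hden : den w (sec₁ (fun w : ℂ => -w ^ 2) y.1.1 w) ≠ 0 :=
    den_ne_zero_of_norm_lt_two (hc.trans_lt (by norm_num))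
  rw [out₁_apply, jets₁_apply_of_norm_lt hr k y hw, 𝒥.phiCut₁_eq_jetOp₁ hc,
    𝒥.crOp₁_eq_jetOp₁ (differentiableAt_sec₁_T y w) (differentiableAt_sec₁_N y w) hden]

/-! ### The clutching law on the small set -/

/-- The image point avoids the pole: `z (1 + |z|²) + ξ₀ z ≠ 0` for `‖z‖ ≥ 1/3` and `|ξ₀ z| < 1/4`.
[folklore] -/
theorem num_ne_zero_of_norm {z c : ℂ} (hz : 3⁻¹ ≤ ‖z‖) (hc : ‖c‖ < 4⁻¹) :
    z * (1 + (Complex.normSq z : ℂ)) + c ≠ 0 := by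
  intro h
  have h1 : z * (1 + (Complex.normSq z : ℂ)) = -c := eq_neg_of_add_eq_zero_left h
  have h2 : ‖z * (1 + (Complex.normSq z : ℂ))‖ = ‖z‖ * (1 + ‖z‖ ^ 2) := by
    rw [norm_mul, Complex.normSq_eq_norm_sq]
    congr 1
    rw [show (1 + ((‖z‖ ^ 2 : ℝ) : ℂ) : ℂ) = ((1 + ‖z‖ ^ 2 : ℝ) : ℂ) by push_cast; ring,
      Complex.norm_real, Real.norm_of_nonneg (by positivity)]
  have h3 : ‖z‖ * (1 + ‖z‖ ^ 2) = ‖c‖ := by rw [← h2, h1, norm_neg]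
  nlinarith [norm_nonneg z, norm_nonneg c, sq_nonneg ‖z‖]

/-- **The clutching law for the honest operators of a small `y`**, at `z ≠ 0` with
`1/3 ≤ ‖z‖ < 4`. [cite: Wendl2018, Thm. 2.46] -/
theorem crOp₁_eq_of_small {y : SecPair k r} (hy : Small hr k y) {z : ℂ} (hz0 : z ≠ 0)
    (hz3 : 3⁻¹ ≤ ‖z‖) (hz4 : ‖z‖ < 4) :
    𝒥.crOp₁ (sec₁ (fun w : ℂ => -w ^ 2) y.1.1) (sec₁ (1 : ℂ → ℂ) y.2.1) z⁻¹ =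
      ((z⁻¹ ^ 2 * ((starRingEnd ℂ) z⁻¹)⁻¹ ^ 2) *
          (𝒥.crOp₀ (sec₀ (fun w : ℂ => -w ^ 2) y.1.1) (sec₀ (1 : ℂ → ℂ) y.2.1) z).1,
        (-((starRingEnd ℂ) z⁻¹)⁻¹ ^ 2) *
          (𝒥.crOp₀ (sec₀ (fun w : ℂ => -w ^ 2) y.1.1) (sec₀ (1 : ℂ → ℂ) y.2.1) z).2) := by
  have hne : ∀ᶠ w in 𝓝 z⁻¹, w ≠ 0 := isOpen_ne.mem_nhds (inv_ne_zero hz0)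
  have hξ : sec₁ (fun w : ℂ => -w ^ 2) y.1.1 =ᶠ[𝓝 z⁻¹]
      fun w => -w ^ 2 * sec₀ (fun w : ℂ => -w ^ 2) y.1.1 w⁻¹ := by
    filter_upwards [hne] with w hw
    rw [sec₁_eq_smul_sec₀ y.1.2 neg_sq_clutch_ne_zero hw, smul_eq_mul]
  have hf : sec₁ (1 : ℂ → ℂ) y.2.1 =ᶠ[𝓝 z⁻¹] fun w => sec₀ (1 : ℂ → ℂ) y.2.1 w⁻¹ := by
    filter_upwards [hne] with w hw
    rw [sec₁_eq_smul_sec₀ y.2.2 one_clutch_ne_zero hw, Pi.one_apply, one_smul]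
  have hc := norm_sec₀_lt_of_small hy hz4.le
  exact 𝒥.crOp₁_eq hz0 (differentiableAt_sec₀_T y z) (differentiableAt_sec₀_N y z) hξ hf
    (den_ne_zero_of_norm_lt_two (hc.trans (by norm_num))) (num_ne_zero_of_norm hz3 hc)

/-! ### The tangent and normal pieces and their membership in the section spaces -/

variable (hr k)

/-- **The tangent pieces** `PT y = ((out₀ y)₁, (out₁ y)₁)`. [cite: Wendl2018, Thm. 2.46] -/
def PT (y : SecPair k r) : ContDiffHolderFunction ℂ ℂ k r × ContDiffHolderFunction ℂ ℂ k r :=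
  (ContDiffHolderFunction.postcompCLM (ContinuousLinearMap.fst ℝ ℂ ℂ) (𝒥.out₀ hr k y),
    ContDiffHolderFunction.postcompCLM (ContinuousLinearMap.fst ℝ ℂ ℂ) (𝒥.out₁ hr k y))

/-- **The normal pieces** `PN y = ((out₀ y)₂, (out₁ y)₂)`. [cite: Wendl2018, Thm. 2.46] -/
def PN (y : SecPair k r) : ContDiffHolderFunction ℂ ℂ k r × ContDiffHolderFunction ℂ ℂ k r :=
  (ContDiffHolderFunction.postcompCLM (ContinuousLinearMap.snd ℝ ℂ ℂ) (𝒥.out₀ hr k y),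
    ContDiffHolderFunction.postcompCLM (ContinuousLinearMap.snd ℝ ℂ ℂ) (𝒥.out₁ hr k y))

/-- Pointwise values of `PT`. [folklore] -/
@[simp] theorem PT_fst_apply (y : SecPair k r) (z : ℂ) : (𝒥.PT hr k y).1 z = (𝒥.out₀ hr k y z).1 :=
  rfl

/-- Pointwise values of `PT`. [folklore] -/
@[simp] theorem PT_snd_apply (y : SecPair k r) (w : ℂ) : (𝒥.PT hr k y).2 w = (𝒥.out₁ hr k y w).1 :=
  rfl

/-- Pointwise values of `PN`. [folklore] -/
@[simp] theorem PN_fst_apply (y : SecPair k r) (z : ℂ) : (𝒥.PN hr k y).1 z = (𝒥.out₀ hr k y z).2 :=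
  rfl

/-- Pointwise values of `PN`. [folklore] -/
@[simp] theorem PN_snd_apply (y : SecPair k r) (w : ℂ) : (𝒥.PN hr k y).2 w = (𝒥.out₁ hr k y w).2 :=
  rfl

/-- `PT` is `C^∞`. [folklore] -/
theorem contDiff_PT : ContDiff ℝ ∞ (𝒥.PT hr k) :=
  ((ContDiffHolderFunction.postcompCLM (ContinuousLinearMap.fst ℝ ℂ ℂ)).contDiff.comp
    (𝒥.contDiff_out₀ hr k)).prodMk
    ((ContDiffHolderFunction.postcompCLM (ContinuousLinearMap.fst ℝ ℂ ℂ)).contDiff.comp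
      (𝒥.contDiff_out₁ hr k))

/-- `PN` is `C^∞`. [folklore] -/
theorem contDiff_PN : ContDiff ℝ ∞ (𝒥.PN hr k) :=
  ((ContDiffHolderFunction.postcompCLM (ContinuousLinearMap.snd ℝ ℂ ℂ)).contDiff.comp
    (𝒥.contDiff_out₀ hr k)).prodMk
    ((ContDiffHolderFunction.postcompCLM (ContinuousLinearMap.snd ℝ ℂ ℂ)).contDiff.comp
      (𝒥.contDiff_out₁ hr k))

/-- The derivative of `PT` at `y`. [folklore] -/
def dPT (y : SecPair k r) :
    SecPair k r →L[ℝ] ContDiffHolderFunction ℂ ℂ k r × ContDiffHolderFunction ℂ ℂ k r :=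
  ((ContDiffHolderFunction.postcompCLM (ContinuousLinearMap.fst ℝ ℂ ℂ)).comp (𝒥.dout₀ hr k y)).prod
    ((ContDiffHolderFunction.postcompCLM (ContinuousLinearMap.fst ℝ ℂ ℂ)).comp (𝒥.dout₁ hr k y))

/-- The derivative of `PN` at `y`. [folklore] -/
def dPN (y : SecPair k r) :
    SecPair k r →L[ℝ] ContDiffHolderFunction ℂ ℂ k r × ContDiffHolderFunction ℂ ℂ k r :=
  ((ContDiffHolderFunction.postcompCLM (ContinuousLinearMap.snd ℝ ℂ ℂ)).comp (𝒥.dout₀ hr k y)).prod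
    ((ContDiffHolderFunction.postcompCLM (ContinuousLinearMap.snd ℝ ℂ ℂ)).comp (𝒥.dout₁ hr k y))

/-- `PT` has derivative `dPT y` at `y`. [folklore] -/
theorem hasFDerivAt_PT (y : SecPair k r) : HasFDerivAt (𝒥.PT hr k) (𝒥.dPT hr k y) y :=
  ((ContDiffHolderFunction.postcompCLM (ContinuousLinearMap.fst ℝ ℂ ℂ)).hasFDerivAt.comp y
    (𝒥.hasFDerivAt_out₀ hr k y)).prodMk
    ((ContDiffHolderFunction.postcompCLM (ContinuousLinearMap.fst ℝ ℂ ℂ)).hasFDerivAt.comp y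
      (𝒥.hasFDerivAt_out₁ hr k y))

/-- `PN` has derivative `dPN y` at `y`. [folklore] -/
theorem hasFDerivAt_PN (y : SecPair k r) : HasFDerivAt (𝒥.PN hr k) (𝒥.dPN hr k y) y :=
  ((ContDiffHolderFunction.postcompCLM (ContinuousLinearMap.snd ℝ ℂ ℂ)).hasFDerivAt.comp y
    (𝒥.hasFDerivAt_out₀ hr k y)).prodMk
    ((ContDiffHolderFunction.postcompCLM (ContinuousLinearMap.snd ℝ ℂ ℂ)).hasFDerivAt.comp y
      (𝒥.hasFDerivAt_out₁ hr k y))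

/-- Pointwise values of `dPT`. [folklore] -/
@[simp] theorem dPT_apply_fst (y δ : SecPair k r) (z : ℂ) :
    (𝒥.dPT hr k y δ).1 z = (𝒥.dout₀ hr k y δ z).1 := rfl

/-- Pointwise values of `dPT`. [folklore] -/
@[simp] theorem dPT_apply_snd (y δ : SecPair k r) (w : ℂ) :
    (𝒥.dPT hr k y δ).2 w = (𝒥.dout₁ hr k y δ w).1 := rfl

/-- Pointwise values of `dPN`. [folklore] -/
@[simp] theorem dPN_apply_fst (y δ : SecPair k r) (z : ℂ) :
    (𝒥.dPN hr k y δ).1 z = (𝒥.dout₀ hr k y δ z).2 := rfl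

/-- Pointwise values of `dPN`. [folklore] -/
@[simp] theorem dPN_apply_snd (y δ : SecPair k r) (w : ℂ) :
    (𝒥.dPN hr k y δ).2 w = (𝒥.dout₁ hr k y δ w).2 := rfl

/-- `PT 0 = 0`. [folklore] -/
theorem PT_zero : 𝒥.PT hr k 0 = 0 := by
  simp only [PT, 𝒥.out₀_zero, 𝒥.out₁_zero, map_zero, Prod.mk_zero_zero]

/-- `PN 0 = 0`. [folklore] -/
theorem PN_zero : 𝒥.PN hr k 0 = 0 := by
  simp only [PN, 𝒥.out₀_zero, 𝒥.out₁_zero, map_zero, Prod.mk_zero_zero]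

variable {hr k}

/-- **Membership of the normal pieces**: for small `y`, `PN y ∈ 𝓗^{k,r}_{dbarClutch 1}` — the
pieces are `ρ`-cut representatives of a `(0,1)`-form with values in the trivial normal bundle
(the clutching law `crOp₁_eq`). [cite: Wendl2018, Thm. 2.46] -/
theorem PN_mem {y : SecPair k r} (hy : Small hr k y) :
    𝒥.PN hr k y ∈ holderSections ℂ (dbarClutch (1 : ℂ → ℂ)) k r := by
  refine ⟨fun z hz => ?_, fun w hw => ?_⟩
  · -- piece relation (i) at `z`, `1/2 ≤ ‖z‖`
    by_cases h3 : 3 ≤ ‖z‖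
    · rw [PN_fst_apply, PN_snd_apply, 𝒥.out₀_apply_of_le hr k y h3, rhoCut_eq_zero h3]
      simp
    · rw [not_le] at h3
      have hz0 : z ≠ 0 := ne_zero_of_half_le_norm hz
      have hw2 : ‖z⁻¹‖ ≤ 2 := norm_inv_le_two_of_half_le hz
      have hcl := 𝒥.crOp₁_eq_of_small hy hz0 (le_trans (by norm_num) hz) (h3.trans (by norm_num))
      rw [PN_fst_apply, PN_snd_apply, 𝒥.out₀_apply_of_small hy (h3.trans (by norm_num)),
        𝒥.out₁_apply_of_small hy (hw2.trans_lt (by norm_num)), rhoCut_eq_one hw2, one_smul, hcl,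
        Prod.smul_snd]
      have hτ : dbarClutch (1 : ℂ → ℂ) z⁻¹ ≠ 0 :=
        dbarClutch_ne_zero_of one_clutch_ne_zero z⁻¹ (inv_ne_zero hz0)
      simp only [dbarClutch, Pi.one_apply, one_mul, smul_eq_mul, Complex.real_smul] at hτ ⊢
      rw [mul_assoc, inv_mul_cancel_left₀ hτ]
  · -- piece relation (ii) at `w`, `1/2 ≤ ‖w‖`
    by_cases h3 : 3 ≤ ‖w‖
    · rw [PN_fst_apply, PN_snd_apply, 𝒥.out₁_apply_of_le hr k y h3, rhoCut_eq_zero h3]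
      simp
    · rw [not_le] at h3
      have hw0 : w ≠ 0 := ne_zero_of_half_le_norm hw
      have hz2 : ‖w⁻¹‖ ≤ 2 := norm_inv_le_two_of_half_le hw
      have hz3 : 3⁻¹ ≤ ‖w⁻¹‖ := by
        rw [norm_inv]
        exact (inv_le_inv₀ (by norm_num) (norm_pos_iff.2 hw0)).2 h3.le |>.trans_eq' (by norm_num)
      have hcl := 𝒥.crOp₁_eq_of_small hy (inv_ne_zero hw0) hz3 (hz2.trans_lt (by norm_num))
      rw [inv_inv] at hcl
      rw [PN_fst_apply, PN_snd_apply, 𝒥.out₁_apply_of_small hy (h3.trans (by norm_num)),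
        𝒥.out₀_apply_of_small hy (hz2.trans_lt (by norm_num)), rhoCut_eq_one hz2, one_smul, hcl,
        Prod.smul_snd]
      simp only [dbarClutch, Pi.one_apply, one_mul, smul_eq_mul, Complex.real_smul]
      ring

/-- **Membership of the tangent pieces**: for small `y`, `PT y ∈ 𝓗^{k,r}_{dbarClutch (-w²)}`.
[cite: Wendl2018, Thm. 2.46] -/
theorem PT_mem {y : SecPair k r} (hy : Small hr k y) :
    𝒥.PT hr k y ∈ holderSections ℂ (dbarClutch (fun w : ℂ => -w ^ 2)) k r := by
  refine ⟨fun z hz => ?_, fun w hw => ?_⟩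
  · by_cases h3 : 3 ≤ ‖z‖
    · rw [PT_fst_apply, PT_snd_apply, 𝒥.out₀_apply_of_le hr k y h3, rhoCut_eq_zero h3]
      simp
    · rw [not_le] at h3
      have hz0 : z ≠ 0 := ne_zero_of_half_le_norm hz
      have hw2 : ‖z⁻¹‖ ≤ 2 := norm_inv_le_two_of_half_le hz
      have hcl := 𝒥.crOp₁_eq_of_small hy hz0 (le_trans (by norm_num) hz) (h3.trans (by norm_num))
      rw [PT_fst_apply, PT_snd_apply, 𝒥.out₀_apply_of_small hy (h3.trans (by norm_num)),
        𝒥.out₁_apply_of_small hy (hw2.trans_lt (by norm_num)), rhoCut_eq_one hw2, one_smul, hcl,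
        Prod.smul_fst]
      have hτ : dbarClutch (fun w : ℂ => -w ^ 2) z⁻¹ ≠ 0 :=
        dbarClutch_ne_zero_of neg_sq_clutch_ne_zero z⁻¹ (inv_ne_zero hz0)
      simp only [dbarClutch, neg_mul, neg_neg, smul_eq_mul, Complex.real_smul] at hτ ⊢
      rw [mul_assoc, inv_mul_cancel_left₀ hτ]
  · by_cases h3 : 3 ≤ ‖w‖
    · rw [PT_fst_apply, PT_snd_apply, 𝒥.out₁_apply_of_le hr k y h3, rhoCut_eq_zero h3]
      simp
    · rw [not_le] at h3
      have hw0 : w ≠ 0 := ne_zero_of_half_le_norm hw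
      have hz2 : ‖w⁻¹‖ ≤ 2 := norm_inv_le_two_of_half_le hw
      have hz3 : 3⁻¹ ≤ ‖w⁻¹‖ := by
        rw [norm_inv]
        exact (inv_le_inv₀ (by norm_num) (norm_pos_iff.2 hw0)).2 h3.le |>.trans_eq' (by norm_num)
      have hcl := 𝒥.crOp₁_eq_of_small hy (inv_ne_zero hw0) hz3 (hz2.trans_lt (by norm_num))
      rw [inv_inv] at hcl
      rw [PT_fst_apply, PT_snd_apply, 𝒥.out₁_apply_of_small hy (h3.trans (by norm_num)),
        𝒥.out₀_apply_of_small hy (hz2.trans_lt (by norm_num)), rhoCut_eq_one hz2, one_smul, hcl,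
        Prod.smul_fst]
      simp only [dbarClutch, smul_eq_mul, Complex.real_smul]
      ring

end SphereACData

end SphereCR

end Literature.Geometry.Symplectic

end
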